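import Summits.AtomisticToContinuum.Crystallization.Theorems.ChartedPlanarOrderStraddleLipschitz

-- PART A of lens-3 g24 `ChartedPlanarOrderTubeChannels.lean` v3 (sha256 3e7f449b59e1cdbe…, 761 l; this part = its lines 71–253): §1 channels,
-- §2 finite-sum tools, §3 the two channel pieces + dominance data.  Tree-only import.  PART B (§4–§7 rearrangement + THE SEAM) imports A;
-- PART C (§8 leaf structure, §9 W′ level, §10 leaves, §11 record corollaries — the only part importing (w) `…TubeLipschitz`) imports B.
-- Declarations byte-identical to the single file; the module docstring below is the single file's, repeated in each part.

/-!
# 7c′ᶜ ⟸ CHANNEL DOMINANCE — a typed split beneath the convexity half of slot 7c′, with the seam PROVED (decomp-a2c lens-3 g24, task (x))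

Slot 7c′ of lens-4's UniformCut cone is, after (t) `…TubeConvexSplit`, (u) `…StraddleLipschitz`, (v) `…PairModulus` and (w) `…TubeLipschitz`,
its CONVEXITY HALF 7c′ᶜ `TubeConvexityW' (17/16) (1/40)` alone: the global ℓ²-monotonicity (`IsTubeConvex a b w ρ λ`, `λ > 0`) of the gap-stress
map `h ↦ (gapStress a b m h)_m` on the `ρ`-tube round the increment profile of every admissible zero-gap-stress stacked configuration.

## The split (why CHANNELS and not norms)

Pair the gap-stress difference with `d = h − h'` and rearrange by layer pairs `(k, l)`:
`Σ_m ⟪ΔgapStress_m, d_m⟫ = Σ_{k<l} ⟪ΔF_{kl}, D_{kl}⟫`, `D_{kl} = Σ_{k<i≤l} d_i` (`sum_inner_partial_eq`, `sum_filter_eq_Df`).  ADJACENT pairs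
(`l = k + 1`, `D = d_l`) carry the stiffness; FAR pairs (span `s = l − k ≥ 2`) may soften, and `‖D_{kl}‖² ≤ s Σ_window ‖d_i‖²` costs a factor `s`
per pair and `s` pairs per site, i.e. `s²` per span.  The ISOTROPIC version of this bookkeeping needs `λ₁ > Σ_{s≥2} s² τ_s` with ONE adjacent modulus
`λ₁` against the far pair moduli `τ_s` — that is exactly the scalar own-gap dominance RETIRED by critic R1 / census TAG 161 (numerically thin at
`ρ = 1/40`, false at `ρ ≥ 1/50`): the adjacent secant form is stiff in the NORMAL channel (`k_nn ≈ 20`) and soft in the TANGENTIAL one, while the far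
softening is almost entirely NORMAL.  Census TAG 161b (i) read BLOCKWISE passes with lateral margin `1.66–2.31` at `ρ = 0.04`.  Hence the split is by
CHANNELS with respect to a unit normal `ν` (`tng ν x = x − ⟪ν, x⟫ ν`, `⟪ν, x⟫`), in DIAGONAL form — tangential/normal cross blocks are absorbed
by the certifier with weighted AM–GM (`cross_absorb`: `2 c x y ≤ p x² + q y²` for `c² ≤ p q`), the weight at his choice, per pair type and span:

* ★ CHᴬ `IsAdjacentChannelMono a b w ρ ν λ_T λ_N` — on every tube window the adjacent-layer force map has secant form `≥ λ_T ‖d_T‖² + λ_N d_N²`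
  [CERT: ONE explicit planar lattice sum on ONE ball of radius `ρ`];
* ★ CHꜰ `IsFarChannelModulus a b w ρ ν μ_T μ_N` — for spans `s ≥ 2` the pair force map has secant form `≥ −(μ_T(s) ‖D_T‖² + μ_N(s) D_N²)`
  [CERT for small `s` · ANALYTIC tail, one derivative up from (v)'s `O(s⁻⁶)` Lipschitz span moduli];
* the DOMINANCE is required IN EACH CHANNEL SEPARATELY: `λ + Σ_{s≥2} s² μ_T(s) ≤ λ_T` and `λ + Σ_{s≥2} s² μ_N(s) ≤ λ_N` (`TubeChannelData a b w ρ`;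
  the span-square budgets are uniform bounds `B_T`, `B_N` on the partial sums — no tsum bookkeeping for the consumer).

## Proved here (sorry-free; standard axioms)

* ★★ `isTubeConvex_of_channels` — THE SEAM: straddle summability on the tube + CHᴬ + CHꜰ + channelwise dominance ⇒ `IsTubeConvex a b w ρ λ`
  (finite Fubini over boxes of layer pairs, Jensen on the windows, the window count `sum_window_weight_le`
  (`≤ s` windows of span `s` per site, uniformly in the box), and the limit `R → ∞` through `HasSum` of the straddle families);
  `tubeConvexityData_of_channels` (data level);
* ★ the LEAF STRUCTURE of CHꜰ (§8): `isFarChannelModulus_of_isPairModulus` (Cauchy–Schwarz: a Lipschitz span modulus is an isotropic far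
  channel modulus — adequate for the TAIL of spans only), `IsFarChannelModulusBelow … s₀` (the finitely many spans `< s₀`, CERT),
  `isFarChannelModulus_splice`, `splice_budget`, `tubeChannelData_of_certs` (CHᴬ + finitely many far certificates + one Lipschitz tail with an
  explicit budget + arithmetic ⇒ channel dominance data);
* ★ W′ level: `TubeChannelsW' Λ ρ` / `TubeChannelsW Λ ρ` (binder lists of `TubeConvexW'` / `TubeConvexW` verbatim) and
  `tubeConvexityW'_of_pairModulus_channels : PairModulusW' Λ ρ → TubeChannelsW' Λ ρ → TubeConvexityW' Λ ρ` (tube summability from the pair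
  moduli via (u)'s `summable_famOf_tube`);
* ★ W′-level LEAVES with explicit constant slots (§10): `AdjacentChannelW' Λ ρ λ_T λ_N`, `FarChannelBelowW' Λ ρ μ_T μ_N s₀`,
  `PairModulusTailW' Λ ρ s₀ B₂` (channels w.r.t. any unit normal `ν ⊥ a, b`; `exists_unit_normal` from `cleanStackedIndependentW`) and the glue
  `tubeChannelsW'_of_leaves : … → TubeChannelsW' Λ ρ`; `tubeConvexW'_record_of_leaves` (§11);
* ★★ unconditional in the range of (v)/(w) (`Λ ≤ 17/16`, `ρ < 19/50`): `tubeConvexityW'_of_channels`, `tubeConvexW'_of_channels`,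
  `tubeConvexW'_record_of_channels : TubeChannelsW' (17/16) (1/40) → TubeConvexW' (17/16) (1/40)`, the F2 feeder `tubeUniquenessW_of_channels`,
  the PS column `profileSlavingLJW_of_channels`, and lens-4's RDEF cone with slot 7 = CH: `rdef_of_grossU_shape_gluing_pinning_channels`
  (+ `_record` at `(2, 17/16; 1/40, 3/16)`).

So: SLOT 7c′ ⟸ 7c′ᶜ ⟸ CH `TubeChannelsW' (17/16) (1/40)` ⟸ LEAVES `AdjacentChannelW'` ∧ `FarChannelBelowW' … s₀` ∧ `PairModulusTailW' … s₀ B₂`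
∧ arithmetic, whose content is two families of EXPLICIT-FUNCTION-ON-A-BALL certificates (one adjacent, finitely many far) plus an analytic tail — the block-Toeplitz symbol certificate asked of lens-3 g25 (critic row 472) in secant (derivative-free) form.

Conventions: `E3 = EuclideanSpace ℝ (Fin 3)` (`…ChunkFloor.E3`); `tube`, `incr`, `gapStress`, `offsetOf`, `layerForce`, `Straddle` from
`…ProfileSlavingLJ`; `famOf` from `…TubeMonotoneSplit`.  No instances, no notation, no new axioms.
-/

noncomputable section

namespace Summit.AtomisticToContinuum.Crystallization.Theorems.ChartedPlanarOrderTubeChannels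

open Finset Metric Filter Topology
open scoped RealInnerProductSpace
open Summit.AtomisticToContinuum.Crystallization.Theorems.ChartedPlanarOrderChunkFloor (E3)
open Summit.AtomisticToContinuum.Crystallization.Theorems.ChartedPlanarOrderProfileSlavingLJ (Straddle IsStacked gapStress incr tube
  offsetOf layerForce)
open Summit.AtomisticToContinuum.Crystallization.Theorems.ChartedPlanarOrderTubeMonotoneSplit (IsPairModulus famOf gapStress_eq_tsum
  offsetOf_pred)
open Summit.AtomisticToContinuum.Crystallization.Theorems.ChartedPlanarOrderTubeConvex (IsTubeConvex)
open Summit.AtomisticToContinuum.Crystallization.Theorems.ChartedPlanarOrderTubeConvexSplit (TubeConvexityData)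

/-! ## §1 Channels: tangential / normal components with respect to a unit vector `ν` -/

/-- the tangential component of `x` with respect to `ν`: `x − ⟪ν, x⟫ ν`. -/
def tng (ν x : E3) : E3 := x - ⟪ν, x⟫ • ν

/-- `tng ν 0 = 0`. -/
theorem tng_zero (ν : E3) : tng ν 0 = 0 := by simp [tng]

/-- `tng ν` is compatible with subtraction. -/
theorem tng_sub (ν x y : E3) : tng ν (x - y) = tng ν x - tng ν y := by
  simp only [tng, inner_sub_right, sub_smul]
  abel

/-- `tng ν` commutes with finite sums. -/
theorem tng_sum {ι : Type*} (ν : E3) (s : Finset ι) (f : ι → E3) : tng ν (∑ i ∈ s, f i) = ∑ i ∈ s, tng ν (f i) := by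
  simp only [tng, inner_sum, Finset.sum_smul, Finset.sum_sub_distrib]

/-- Pythagoras in channels for a unit `ν`: `‖x‖² = ‖tng ν x‖² + ⟪ν, x⟫²`. -/
theorem norm_sq_channels {ν : E3} (hν : ‖ν‖ = 1) (x : E3) : ‖x‖ ^ 2 = ‖tng ν x‖ ^ 2 + ⟪ν, x⟫ ^ 2 := by
  have hc : ⟪x, ν⟫ = ⟪ν, x⟫ := real_inner_comm _ _
  have h2 : ‖tng ν x‖ ^ 2 = ‖x‖ ^ 2 - 2 * ⟪x, ⟪ν, x⟫ • ν⟫ + ‖⟪ν, x⟫ • ν‖ ^ 2 := norm_sub_sq_real _ _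
  rw [real_inner_smul_right, norm_smul, Real.norm_eq_abs, hν, mul_one, sq_abs, hc] at h2
  nlinarith [h2]

/-- weighted AM–GM, the tool by which a CERTIFIER absorbs the tangential/normal CROSS block of a secant form into the diagonal channel
moduli before feeding the pieces below: `2 c x y ≤ p x² + q y²` whenever `p, q ≥ 0` and `c² ≤ p q` (e.g. `p = |c| θ`, `q = |c| / θ`). -/
theorem cross_absorb {c p q : ℝ} (hp : 0 ≤ p) (hq : 0 ≤ q) (h : c ^ 2 ≤ p * q) (x y : ℝ) :
    2 * c * (x * y) ≤ p * x ^ 2 + q * y ^ 2 := by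
  rcases hp.eq_or_lt with hp0 | hp0
  · have hc2 : c ^ 2 ≤ 0 := by rw [← hp0, zero_mul] at h; exact h
    have hc : c = 0 := by nlinarith [sq_nonneg c]
    rw [hc, ← hp0]
    nlinarith [sq_nonneg y]
  · have key : 0 ≤ p * (p * x ^ 2 + q * y ^ 2 - 2 * c * (x * y)) := by
      nlinarith [sq_nonneg (p * x - c * y), sq_nonneg y, h]
    nlinarith [(mul_nonneg_iff_of_pos_left hp0).mp key]

/-! ## §2 Finite-sum inequalities and counting -/

/-- Jensen / Cauchy–Schwarz for a finite sum of vectors: `‖Σ f‖² ≤ #s · Σ ‖f‖²`. -/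
theorem norm_sum_sq_le {ι : Type*} (s : Finset ι) (f : ι → E3) :
    ‖∑ i ∈ s, f i‖ ^ 2 ≤ (s.card : ℝ) * ∑ i ∈ s, ‖f i‖ ^ 2 := by
  calc ‖∑ i ∈ s, f i‖ ^ 2 ≤ (∑ i ∈ s, ‖f i‖) ^ 2 :=
        pow_le_pow_left₀ (norm_nonneg _) (norm_sum_le _ _) 2
    _ ≤ (s.card : ℝ) * ∑ i ∈ s, ‖f i‖ ^ 2 := sq_sum_le_card_mul_sum_sq

/-- `#(Ioc k l) = (l − k).toNat` as a real number. -/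
theorem card_Ioc_real (k l : ℤ) : ((Ioc k l).card : ℝ) = ((l - k).toNat : ℝ) := by
  rw [Int.card_Ioc]

/-- the pairs `(k, k + s)` with `k < i ≤ k + s` inside any finite set of pairs number at most `s`. -/
theorem card_window_le (P : Finset (ℤ × ℤ)) (i : ℤ) (s : ℕ) :
    ((P.filter (fun q => q.1 < i ∧ i ≤ q.2)).filter (fun q => q.2 = q.1 + (s : ℤ))).card ≤ s := by
  have h := Finset.card_le_card_of_injOn (s := (P.filter (fun q => q.1 < i ∧ i ≤ q.2)).filter (fun q => q.2 = q.1 + (s : ℤ)))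
    (t := Icc (i - (s : ℤ)) (i - 1)) (fun q => q.1) (fun q hq => ?_) (fun q hq q' hq' hqq' => ?_)
  · have hc : (Icc (i - (s : ℤ)) (i - 1)).card = s := by
      rw [Int.card_Icc]; omega
    rwa [hc] at h
  · simp only [Finset.mem_coe, Finset.mem_filter] at hq
    obtain ⟨⟨-, h1, h2⟩, h3⟩ := hq
    simp only [coe_Icc, Set.mem_Icc]
    constructor <;> omega
  · simp only [Finset.mem_coe, Finset.mem_filter] at hq hq'
    obtain ⟨-, h3⟩ := hq
    obtain ⟨-, h3'⟩ := hq'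
    simp only at hqq'
    exact Prod.ext hqq' (by rw [h3, h3', hqq'])

/-- the box of layer pairs `[-R, R]²`. -/
def box (R : ℕ) : Finset (ℤ × ℤ) := Icc (-(R : ℤ)) R ×ˢ Icc (-(R : ℤ)) R

/-- Membership in `box R`. -/
theorem mem_box {R : ℕ} {q : ℤ × ℤ} : q ∈ box R ↔ (-(R : ℤ) ≤ q.1 ∧ q.1 ≤ R) ∧ (-(R : ℤ) ≤ q.2 ∧ q.2 ≤ R) := by
  simp [box, Finset.mem_product]

/-- `box` is monotone in the radius. -/
theorem box_mono {R R' : ℕ} (h : R ≤ R') : box R ⊆ box R' := by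
  intro q hq
  rw [mem_box] at hq ⊢
  have : (R : ℤ) ≤ R' := by exact_mod_cast h
  constructor <;> constructor <;> linarith [hq.1.1, hq.1.2, hq.2.1, hq.2.2]

/-- the FAR pairs of the box: span `≥ 2`. -/
def far (R : ℕ) : Finset (ℤ × ℤ) := (box R).filter (fun q => q.1 + 2 ≤ q.2)

/-- the span of a far pair of the box lies in `[2, 2R]`. -/
theorem span_mem_Ico {R : ℕ} {q : ℤ × ℤ} (hq : q ∈ far R) : (q.2 - q.1).toNat ∈ Finset.Ico 2 (2 * R + 1) := by
  simp only [far, mem_filter, mem_box] at hq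
  obtain ⟨⟨⟨h1, h2⟩, h3, h4⟩, h5⟩ := hq
  simp only [Finset.mem_Ico]
  constructor <;> omega

/-- ★ span-weighted window count: for nonnegative `c` with `Σ_{2 ≤ s < N} s² c s ≤ B` (all `N`), the far pairs of the box whose window
contains `i` carry total weight `Σ s_q · c s_q ≤ B`. -/
theorem sum_window_weight_le {c : ℕ → ℝ} (hc : ∀ s, 0 ≤ c s) {B : ℝ} (hB : ∀ N : ℕ, ∑ s ∈ Finset.Ico 2 N, ((s : ℕ) : ℝ) ^ 2 * c s ≤ B)
    (R : ℕ) (i : ℤ) :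
    ∑ q ∈ (far R).filter (fun q => q.1 < i ∧ i ≤ q.2), ((q.2 - q.1).toNat : ℝ) * c (q.2 - q.1).toNat ≤ B := by
  set P := (far R).filter (fun q => q.1 < i ∧ i ≤ q.2) with hP
  have hmaps : ∀ q ∈ P, (q.2 - q.1).toNat ∈ Finset.Ico 2 (2 * R + 1) := fun q hq =>
    span_mem_Ico (Finset.mem_of_mem_filter q hq)
  rw [← Finset.sum_fiberwise_of_maps_to hmaps]
  refine le_trans (Finset.sum_le_sum fun s hs => ?_) (hB (2 * R + 1))
  have hfib : ∀ q ∈ P.filter (fun q => (q.2 - q.1).toNat = s), ((q.2 - q.1).toNat : ℝ) * c (q.2 - q.1).toNat = (s : ℝ) * c s := by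
    intro q hq
    rw [(Finset.mem_filter.mp hq).2]
  rw [Finset.sum_congr rfl hfib, Finset.sum_const, nsmul_eq_mul]
  have hcard : ((P.filter (fun q => (q.2 - q.1).toNat = s)).card : ℝ) ≤ s := by
    have hsub : P.filter (fun q => (q.2 - q.1).toNat = s) ⊆
        (P.filter (fun q => q.1 < i ∧ i ≤ q.2)).filter (fun q => q.2 = q.1 + (s : ℤ)) := by
      intro q hq
      simp only [Finset.mem_filter] at hq ⊢
      obtain ⟨hqP, hqs⟩ := hq
      have hqP' := hqP
      simp only [hP, far, Finset.mem_filter] at hqP'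
      refine ⟨⟨hqP, hqP'.2⟩, ?_⟩
      omega
    exact_mod_cast (Finset.card_le_card hsub).trans (card_window_le P i s)
  calc ((P.filter (fun q => (q.2 - q.1).toNat = s)).card : ℝ) * ((s : ℝ) * c s)
      ≤ (s : ℝ) * ((s : ℝ) * c s) := mul_le_mul_of_nonneg_right hcard (mul_nonneg (Nat.cast_nonneg _) (hc s))
    _ = (s : ℝ) ^ 2 * c s := by ring

/-- ★ aggregation of windowed sums over the far pairs: for `g ≥ 0` vanishing off `F ⊆ [-R, R]`,
`Σ_{q far} s_q c(s_q) Σ_{i ∈ (k,l]} g i ≤ B · Σ_{i ∈ F} g i`. -/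
theorem sum_far_window_le {c : ℕ → ℝ} (hc : ∀ s, 0 ≤ c s) {B : ℝ} (hB : ∀ N : ℕ, ∑ s ∈ Finset.Ico 2 N, ((s : ℕ) : ℝ) ^ 2 * c s ≤ B)
    {g : ℤ → ℝ} (hg : ∀ i, 0 ≤ g i) {F : Finset ℤ} (hgF : ∀ i, i ∉ F → g i = 0) {R : ℕ}
    (hF : F ⊆ Icc (-(R : ℤ)) R) :
    ∑ q ∈ far R, ((q.2 - q.1).toNat : ℝ) * c (q.2 - q.1).toNat * ∑ i ∈ Ioc q.1 q.2, g i ≤ B * ∑ i ∈ F, g i := by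
  -- rewrite each window sum as a filtered sum over the common range `Icc (-R) R`
  have hwin : ∀ q ∈ far R, ∑ i ∈ Ioc q.1 q.2, g i = ∑ i ∈ Icc (-(R : ℤ)) R, if q.1 < i ∧ i ≤ q.2 then g i else 0 := by
    intro q hq
    simp only [far, mem_filter, mem_box] at hq
    rw [← Finset.sum_filter]
    congr 1
    ext i
    simp only [Finset.mem_Ioc, Finset.mem_filter, Finset.mem_Icc]
    constructor
    · intro h; exact ⟨⟨by omega, by omega⟩, h⟩
    · intro h; exact h.2
  have hFsum : ∑ i ∈ F, g i = ∑ i ∈ Icc (-(R : ℤ)) R, g i :=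
    Finset.sum_subset hF (fun i _ hi => hgF i hi)
  rw [Finset.sum_congr rfl (fun q hq => by rw [hwin q hq]), hFsum]
  have hrw : ∀ i : ℤ, ∑ q ∈ far R, ((q.2 - q.1).toNat : ℝ) * c (q.2 - q.1).toNat * (if q.1 < i ∧ i ≤ q.2 then g i else 0)
      = (∑ q ∈ (far R).filter (fun q => q.1 < i ∧ i ≤ q.2), ((q.2 - q.1).toNat : ℝ) * c (q.2 - q.1).toNat) * g i := by
    intro i
    rw [Finset.sum_mul, Finset.sum_filter]
    refine Finset.sum_congr rfl fun q _ => ?_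
    split_ifs <;> simp
  calc ∑ q ∈ far R, ((q.2 - q.1).toNat : ℝ) * c (q.2 - q.1).toNat * ∑ i ∈ Icc (-(R : ℤ)) R, (if q.1 < i ∧ i ≤ q.2 then g i else 0)
      = ∑ q ∈ far R, ∑ i ∈ Icc (-(R : ℤ)) R,
          ((q.2 - q.1).toNat : ℝ) * c (q.2 - q.1).toNat * (if q.1 < i ∧ i ≤ q.2 then g i else 0) :=
        Finset.sum_congr rfl fun q _ => by rw [Finset.mul_sum]
    _ = ∑ i ∈ Icc (-(R : ℤ)) R, ∑ q ∈ far R,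
          ((q.2 - q.1).toNat : ℝ) * c (q.2 - q.1).toNat * (if q.1 < i ∧ i ≤ q.2 then g i else 0) := Finset.sum_comm
    _ ≤ ∑ i ∈ Icc (-(R : ℤ)) R, B * g i := Finset.sum_le_sum fun i _ => by
        rw [hrw i]
        exact mul_le_mul_of_nonneg_right (sum_window_weight_le hc hB R i) (hg i)
    _ = B * ∑ i ∈ Icc (-(R : ℤ)) R, g i := by rw [Finset.mul_sum]

/-! ## §3 The two channel pieces (configuration level) and the channel dominance data -/

/-- ★ piece CHᴬ · **adjacent-pair channel monotonicity** on the `ρ`-tube round `w`: on every tube window the adjacent-layer force map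
`u ↦ layerForce a b (−u)` has secant form bounded below by the DIAGONAL channel form with TANGENTIAL modulus `λ_T` and NORMAL modulus `λ_N`
(channels w.r.t. the unit normal `ν`: `x_T = tng ν x`, `x_N = ⟪ν, x⟫`).  A certifier holding channel-block bounds `[[A_T, C], [Cᵀ, A_N]]` of the
secant forms on the ball feeds `λ_T = inf A_T − ‖C‖ θ`, `λ_N = inf A_N − ‖C‖ / θ` for a weight `θ > 0` of his choice (`cross_absorb`).
[CERT · ONE explicit planar lattice sum on ONE ball of radius `ρ`; at a 3-fold registry the cross block vanishes at the centre] -/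
def IsAdjacentChannelMono (a b : E3) (w : ℤ → E3) (ρ : ℝ) (ν : E3) (lT lN : ℝ) : Prop :=
  ∀ m : ℤ, ∀ u ∈ tube w ρ m, ∀ u' ∈ tube w ρ m,
    lT * ‖tng ν (u - u')‖ ^ 2 + lN * ⟪ν, u - u'⟫ ^ 2 ≤ ⟪layerForce a b (-u) - layerForce a b (-u'), u - u'⟫

/-- ★ piece CHꜰ · **far-pair channel moduli** on the `ρ`-tube round `w`: for layers `k < l` of span `s = l − k ≥ 2` the pair force map, as a
function of the relative offset along tube profiles, has secant form bounded below by `−(μ_T(s) ‖D_T‖² + μ_N(s) D_N²)` (tangential / normal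
SOFTENING moduli; cross blocks absorbed as in CHᴬ, weight at the certifier's choice, per span).
[CERT for small spans · ANALYTIC tail: one derivative up from (v)'s `O(s⁻⁶)` Lipschitz span moduli] -/
def IsFarChannelModulus (a b : E3) (w : ℤ → E3) (ρ : ℝ) (ν : E3) (μT μN : ℕ → ℝ) : Prop :=
  ∀ k l : ℤ, k + 2 ≤ l → ∀ h h' : ℤ → E3, (∀ i, h i ∈ tube w ρ i) → (∀ i, h' i ∈ tube w ρ i) →
    -(μT (l - k).toNat * ‖tng ν (offsetOf h k l - offsetOf h' k l)‖ ^ 2 + μN (l - k).toNat * ⟪ν, offsetOf h k l - offsetOf h' k l⟫ ^ 2) ≤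
      ⟪layerForce a b (-offsetOf h k l) - layerForce a b (-offsetOf h' k l), offsetOf h k l - offsetOf h' k l⟫

/-- ★ **channel dominance data** round `w` at radius `ρ`: a unit direction `ν`, adjacent channel moduli `(λ_T, λ_N)`, nonnegative far
channel moduli `(μ_T, μ_N)` with span-square budgets `Σ_{2 ≤ s < N} s² μ_T(s) ≤ B_T`, `Σ_{2 ≤ s < N} s² μ_N(s) ≤ B_N` (all `N`), and a constant
`λ > 0` DOMINATED IN EACH CHANNEL SEPARATELY: `λ + B_T ≤ λ_T`, `λ + B_N ≤ λ_N`. -/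
def TubeChannelData (a b : E3) (w : ℤ → E3) (ρ : ℝ) : Prop :=
  ∃ (ν : E3) (lT lN lam BT BN : ℝ) (μT μN : ℕ → ℝ), ‖ν‖ = 1 ∧ (∀ s, 0 ≤ μT s) ∧ (∀ s, 0 ≤ μN s) ∧
    (∀ N : ℕ, ∑ s ∈ Finset.Ico 2 N, ((s : ℕ) : ℝ) ^ 2 * μT s ≤ BT) ∧
    (∀ N : ℕ, ∑ s ∈ Finset.Ico 2 N, ((s : ℕ) : ℝ) ^ 2 * μN s ≤ BN) ∧
    0 < lam ∧ lam + BT ≤ lT ∧ lam + BN ≤ lN ∧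
    IsAdjacentChannelMono a b w ρ ν lT lN ∧ IsFarChannelModulus a b w ρ ν μT μN

end Summit.AtomisticToContinuum.Crystallization.Theorems.ChartedPlanarOrderTubeChannels
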